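import Mathlib
import Literature.AlgebraicGeometry.Resolution.NeronPopescuSingularIdeal
import Literature.AlgebraicGeometry.Resolution.SmoothFactorizationsTransport
import Summits.ResolutionOfSingularities.ResolutionOfSingularities.Theorems.IndSmoothValuativeSmoothingDevissageStepLemmas
import HarnessLib

/-!
# One dévissage step for ind-smoothness of valuation rings (crux `IndSmooth.ValuativeSmoothing`)

Crux `stmt-ResolutionOfSingularities-16087`, line `birth`, lead c1 dévissage programme
"discrete jumps", stub `hasSmoothFactorizations_devissage_step` (stub D).

## What is proved

"PT holds for `R → Λ`" is the tree's `HasSmoothFactorizations R Λ`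
(`Literature/AlgebraicGeometry/Resolution/NeronPopescuSingularIdeal.lean`; Stacks, *Smoothing
Ring Maps*, text after Situation 07F2, in the factorisation form of Algebra, Lemma 07C3 (2)):
every `R`-algebra map `A → Λ` with `A` of finite type over `R` factors through a smooth
`R`-algebra.

Let `O ≤ O'` be valuation subrings of a field `K`, `a ∈ O` a nonzero element generating the
maximal ideal of `O`, with `O' = O[1/a]`; let `F ⊆ O` be an intermediate field of `K/k` and
`F' = F ⊔ k(a) = F(a)`. `hasSmoothFactorizations_devissage_step`: **if** the fibrewise criterion
for PT holds (hypothesis `hA`: `R` Noetherian, `Λ` flat over `R`, PT for every fibre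
`κ(𝔭) → κ(𝔭) ⊗[R] Λ` implies PT for `R → Λ` — the tree's
`hasSmoothFactorizations_of_flat_of_fibre`), **then** PT for `F → O/𝔪_O` and PT for `F' → O'`
imply PT for `F → O`.

## Proof

Take `R = F[X] → O`, `X ↦ a` (ingredients in `IndSmoothValuativeSmoothingDevissageStepLemmas`).
* `a` is transcendental over `F`: a polynomial with nonzero constant term evaluates to a unit of
  `O` (a unit plus an element of `𝔪_O = aO`), so a nonzero `q = Xᵐ q₁`, `q₁(0) ≠ 0`, has
  `q(a) = aᵐ ·` unit `≠ 0`. Hence `O` is torsion free, i.e. flat, over the PID `F[X]`.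
* Generic fibre (`hasSmoothFactorizations_generic_fibre`): `κ(0) = Frac F[X] ≅ F' = F(a)`
  through `X ↦ a`, and `κ(0) ⊗[F[X]] O` and `O' = O[1/a]` are both the localisation of `O` at
  `F[X] ∖ 0` (every `q(a)`, `q ≠ 0`, is `aᵐ` times a unit of `O`, and `a` is invertible in
  `O'`); PT for `F' → O'` is transported along this isomorphism of pairs
  (`hasSmoothFactorizations_congr`).
* Fibre at `(X)`: `κ((X)) ≅ F` and `κ((X)) ⊗[F[X]] O ≅ O/aO = O/𝔪_O`; PT for `F → O/𝔪_O`
  is transported.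
* Fibre at any other nonzero prime: the zero ring, for which PT is trivial.
* So `hA` gives PT for `F[X] → O`, and PT descends along the smooth map `F → F[X]`
  (`hasSmoothFactorizations_of_smooth_base`).

## Sources

* The Stacks Project, *Smoothing Ring Maps* (Tag 07BW): Situation 07F2 (PT), Lemma 07F5;
  *Algebra*, Lemma 07C3. [StacksProject]
* The dévissage along a principal height-one prime of a valuation ring is the lead's
  decomposition of the crux (valuation rings all of whose jumps are discrete); this file is its
  single formal step, elementary commutative algebra throughout. [folklore]
-/

-- single-problem summit: the doubled namespace component is forced
set_option linter.dupNamespace false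

open Polynomial
open scoped TensorProduct

namespace Summit.ResolutionOfSingularities.ResolutionOfSingularities.Theorems.ValuativeSmoothing

open Literature.AlgebraicGeometry.Resolution

namespace DevissageStep

/-! ## The generic fibre of `F[X] → O` is `F' → O'` -/

section GenericFibre

variable {k K : Type} [Field k] [Field K] [Algebra k K] {O O' : ValuationSubring K}
  {F F' : IntermediateField k K} [Algebra F O] [IsScalarTower F O K] [Algebra F' O']
  [IsScalarTower F' O' K] [Algebra O O'] {a : K} (ha : a ∈ O)

omit [Algebra F' O'] [IsScalarTower F' O' K] [Algebra O O'] in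
/-- `q(⟨a, _⟩) ∈ O` is `q(a) ∈ K`. [folklore] -/
theorem coe_aeval_eq (q : F[X]) : ((aeval (⟨a, ha⟩ : O) q : O) : K) = aeval a q :=
  (aeval_algHom_apply (IsScalarTower.toAlgHom F O K) (⟨a, ha⟩ : O) q).symm

/-- **The generic fibre.** If `𝔪_O = aO` with `a ≠ 0`, `F ⊆ O` is an intermediate field of
`K/k`, `F[X] → O` sends `X ↦ a`, `O' = O[1/a] ⊇ O` and `F' = F(a) ⊆ O'` compatibly, then the
generic fibre `κ(0) → κ(0) ⊗[F[X]] O` of `F[X] → O` is isomorphic to the pair `F' → O'`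
(`κ(0) = Frac F[X] ≅ F(a)` by transcendence of `a`, and `κ(0) ⊗[F[X]] O` and `O'` are both the
localisation of `O` at `F[X] ∖ 0`), so PT for `F' → O'` gives PT for the generic fibre.
[folklore] -/
theorem hasSmoothFactorizations_generic_fibre [Algebra F[X] O] (ha0 : a ≠ 0)
    (hmax : IsLocalRing.maximalIdeal O = Ideal.span {(⟨a, ha⟩ : O)})
    (hO' : ∀ x : K, x ∈ O' ↔ ∃ n : ℕ, a ^ n * x ∈ O)
    (hF' : F' = F ⊔ IntermediateField.adjoin k {a})
    (halg : ∀ q : F[X], algebraMap F[X] O q = aeval (⟨a, ha⟩ : O) q)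
    (hOO' : ∀ y : O, (algebraMap O O' y : K) = y)
    (h2 : HasSmoothFactorizations F' O') :
    HasSmoothFactorizations (⊥ : Ideal F[X]).ResidueField
      ((⊥ : Ideal F[X]).ResidueField ⊗[F[X]] O) := by
  -- `κ(0) ⊗ O` as an `O`-algebra on the right factor (a `letI`, not a local instance attribute)
  letI : Algebra O ((⊥ : Ideal F[X]).ResidueField ⊗[F[X]] O) :=
    Algebra.TensorProduct.rightAlgebra
  set x : O := ⟨a, ha⟩ with hxdef
  have hx0 : x ≠ 0 := fun h => ha0 (congrArg Subtype.val h)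
  have hinjK : Function.Injective (aeval a : F[X] →ₐ[F] K) := by
    intro p q h
    apply aeval_injective_of_maximalIdeal_eq x hmax hx0
    apply Subtype.ext
    change ((aeval x p : O) : K) = ((aeval x q : O) : K)
    rwa [coe_aeval_eq, coe_aeval_eq]
  obtain ⟨eR, heR⟩ := exists_ringEquiv_residueField_bot F F' a hinjK hF'
  set M := Algebra.algebraMapSubmonoid O (nonZeroDivisors F[X]) with hM
  haveI : IsLocalization M O' := isLocalization_overring ha ha0 hmax hO' halg hOO'
  haveI : IsLocalization M ((⊥ : Ideal F[X]).ResidueField ⊗[F[X]] O) :=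
    IsLocalization.tensorRight (R := F[X]) (S := O) (A := (⊥ : Ideal F[X]).ResidueField)
      (nonZeroDivisors F[X])
  let eΛ : (⊥ : Ideal F[X]).ResidueField ⊗[F[X]] O ≃ₐ[O] O' := IsLocalization.algEquiv M _ _
  refine (hasSmoothFactorizations_congr eR eΛ.toRingEquiv ?_).mpr h2
  intro r
  suffices h : eΛ.toRingEquiv.toRingHom.comp
      (algebraMap _ ((⊥ : Ideal F[X]).ResidueField ⊗[F[X]] O)) =
      (algebraMap F' O').comp eR.toRingHom from RingHom.congr_fun h r
  refine IsLocalization.ringHom_ext (nonZeroDivisors F[X]) (RingHom.ext fun q => Subtype.ext ?_)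
  change ((eΛ (algebraMap _ (_ ⊗[F[X]] O) (algebraMap F[X] (⊥ : Ideal F[X]).ResidueField q))
    : O') : K) = (algebraMap F' O' (eR (algebraMap F[X] _ q)) : K)
  have h1 : algebraMap _ ((⊥ : Ideal F[X]).ResidueField ⊗[F[X]] O)
      (algebraMap F[X] (⊥ : Ideal F[X]).ResidueField q) =
      algebraMap O ((⊥ : Ideal F[X]).ResidueField ⊗[F[X]] O) (algebraMap F[X] O q) := by
    rw [← IsScalarTower.algebraMap_apply, ← IsScalarTower.algebraMap_apply]
  have hR : ∀ z : F', ((algebraMap F' O' z : O') : K) = (z : K) := fun z =>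
    (IsScalarTower.algebraMap_apply F' O' K z).symm
  rw [h1, AlgEquiv.commutes, hOO', halg, coe_aeval_eq, hR, heR]

end GenericFibre

end DevissageStep

open DevissageStep in
/-- Stub D: **one dévissage step along a generator of a principal maximal ideal.** Let
`O ≤ O' = O[1/a]` be valuation subrings of `K` with `𝔪_O = aO`, `a ≠ 0`, `F ⊆ O` an
intermediate field of `K/k` and `F' = F(a)`. Assuming the fibrewise criterion `hA` for PT
(Noetherian base, flat target), PT for `F → O/𝔪_O` and PT for `F' → O'` imply PT for `F → O`.
Proof: apply `hA` to `F[X] → O`, `X ↦ a` (flat since `a` is transcendental over `F`), whose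
fibres are `F' → O'` (generic), `F → O/𝔪_O` (at `(X)`) and zero (elsewhere); then descend PT
along the smooth map `F → F[X]`. [folklore] -/
theorem hasSmoothFactorizations_devissage_step
    (hA : ∀ (R Λ : Type) [CommRing R] [CommRing Λ] [Algebra R Λ] [IsNoetherianRing R]
      [Module.Flat R Λ],
      (∀ (p : Ideal R) [p.IsPrime],
        Literature.AlgebraicGeometry.Resolution.HasSmoothFactorizations p.ResidueField
          (TensorProduct R p.ResidueField Λ)) →
      Literature.AlgebraicGeometry.Resolution.HasSmoothFactorizations R Λ)
    (k K : Type) [Field k] [Field K] [Algebra k K]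
    (O O' : ValuationSubring K) (hle : O ≤ O') (a : K) (ha : a ∈ O) (ha0 : a ≠ 0)
    (hmax : IsLocalRing.maximalIdeal O = Ideal.span {(⟨a, ha⟩ : O)})
    (hO' : ∀ x : K, x ∈ O' ↔ ∃ n : ℕ, a ^ n * x ∈ O)
    (F F' : IntermediateField k K) (hFO : ∀ x : K, x ∈ F → x ∈ O)
    (hF' : F' = F ⊔ IntermediateField.adjoin k {a})
    [Algebra F O] [IsScalarTower F O K] [Algebra F' O'] [IsScalarTower F' O' K]
    [Algebra F (IsLocalRing.ResidueField O)] [IsScalarTower F O (IsLocalRing.ResidueField O)]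
    (h1 : Literature.AlgebraicGeometry.Resolution.HasSmoothFactorizations F
      (IsLocalRing.ResidueField O))
    (h2 : Literature.AlgebraicGeometry.Resolution.HasSmoothFactorizations F' O') :
    Literature.AlgebraicGeometry.Resolution.HasSmoothFactorizations F O := by
  -- `F ⊆ O` is already encoded in the compatible algebra structure `[IsScalarTower F O K]`
  have _hFO := hFO
  set x : O := ⟨a, ha⟩ with hxdef
  -- `O` as an `F[X]`-algebra through `X ↦ a`, `O'` as an `O`-algebra through the inclusion
  letI : Algebra F[X] O := (aeval x : F[X] →ₐ[F] O).toRingHom.toAlgebra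
  have halg : ∀ q : F[X], algebraMap F[X] O q = aeval x q := fun _ => rfl
  haveI : IsScalarTower F F[X] O := IsScalarTower.of_algebraMap_eq fun c => by
    rw [halg, Polynomial.algebraMap_eq, aeval_C]
  letI : Algebra O O' := (O.inclusion O' hle).toAlgebra
  have hOO' : ∀ y : O, (algebraMap O O' y : K) = y := fun _ => rfl
  -- `a` is transcendental over `F`, so `O` is torsion free, i.e. flat, over the PID `F[X]`
  have hx0 : x ≠ 0 := fun h => ha0 (congrArg Subtype.val h)
  have hinj : Function.Injective (algebraMap F[X] O) :=
    aeval_injective_of_maximalIdeal_eq x hmax hx0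
  haveI : Module.IsTorsionFree F[X] O := Module.isTorsionFree_iff_algebraMap_injective.mpr hinj
  haveI : Module.Flat F[X] O := inferInstance
  -- PT for `F[X] → O`, fibre by fibre
  have hPT : HasSmoothFactorizations F[X] O := by
    refine hA F[X] O fun p hp => ?_
    by_cases hp0 : p = ⊥
    · subst hp0
      exact hasSmoothFactorizations_generic_fibre ha ha0 hmax hO' hF' halg hOO' h2
    by_cases hXp : X ∈ p
    · exact hasSmoothFactorizations_closed_fibre hmax (show aeval x X = x from aeval_X x) p hXp h1
    · haveI := subsingleton_fibre hmax halg p hp0 hXp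
      exact hasSmoothFactorizations_of_subsingleton_right _ _
  -- descend along the smooth map `F → F[X]`
  haveI : Algebra.Smooth F F[X] := {}
  exact hasSmoothFactorizations_of_smooth_base hPT

end Summit.ResolutionOfSingularities.ResolutionOfSingularities.Theorems.ValuativeSmoothing
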